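import Summits.RiemannHypothesis.RiemannHypothesis.Theses.DBN
import Literature.NumberTheory.LFunctions.DeBruijnNewmanUpperBoundProofs
import HarnessLib

/-!
# RiemannHypothesis / DBN — crux `DBN.DbnLowAllT` (stmt-RiemannHypothesis-0281) REDUCED to one
# axis-inclusive barrier certificate (the sliding-floor principle)

LINE 1 — LABEL: the principle `no_upper_zero_of_axisBarrier` / `im_eq_zero_of_axisBarrier` is
**RH-FREE** (a statement about de Bruijn's family `H_t = Literature.NumberTheory.LFunctions.deBruijnH t`
with DATA-SHAPED hypotheses: real zeros of `H_0` in a box, no off-axis zero in a unit strip); the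
reduction `dbnLowAllT_of_axisBarrier` is **CONDITIONAL** on the route's two declared computational
named facts F1 = `Literature.NumberTheory.LFunctions.platt_trudgian_numerical_rh` (RH verified to
height `3 000 175 332 800`, Platt–Trudgian 2021 Thm. 1) and
`Literature.NumberTheory.LFunctions.platt_trudgian` (`Λ ≤ 1/5`, = F1 + F3
`Polymath15.table1_row2` by the tree theorem `platt_trudgian_of_numerics`) and on ONE further
certified computation, the axis-inclusive barrier `hbar` below, which has NOT been run.  The crux
`DBN.DbnLowAllT` stays OPEN; this file isolates its residual.  bears_on: N-P (LADDER-RH §1,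
COLUMN 3 DBN, target P2).  WHAT THIS IS NOT: not a proof of `DbnLowAllT`, not a statement uniform
in the height (that is `DBN.DbnHighUniform`, RH-EQUIVALENT), not evidence about RH — an
implication out of numerical facts fixes WHICH computation would close P2; nothing here bears on
the truth of RH.

## The sliding-floor principle (idea card `Cruxes/DbnLowAllT/Ideas/sliding-floor-axis-barrier.md`)

The item's recorded obstruction — Polymath 15's Prop. 3.3 controls only zeros with
`Im z ≥ Y(t) = √(y₀² + 2(t₀ − t)) > 0`, "no near-axis no-crossing lemma in print" — concerns ONE run
of Prop. 3.3.  The tree's PROVED engine `Literature.NumberTheory.LFunctions.Polymath15.not_bad`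
(`DeBruijnNewmanUpperBoundProofs.lean`; hypotheses: `InitialZeroFreeH t₀ X y₀`,
`BarrierZeroFree t₀ X y₀`, `0 < y₀ ≤ 1`; conclusion: no zero of `H_t` in
`R(t) = {0 ≤ Re z ≤ X, Im z ≥ Y(t)}` for any `t ∈ [0, t₀]`) has `(t₀, y₀)` FREE.  Given a putative
zero `w` of `H_t` with `0 ≤ Re w ≤ X` and `Im w > 0`, run it at `t₀ := t`, `y₀ := Im w`: then
`Y(t₀) = y₀ = Im w` (`Yfun_self`), so `w ∈ R(t)` and `t` is a bad time — contradiction — provided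
(i) `H_0` has no zero `x + iy` with `0 ≤ x ≤ X`, `y ≥ √(y₀² + 2t) (> 0)`: implied by "every zero of
`H_0` with `|Re z| ≤ X` is real" (numerical RH in the box), and (ii) `H_s` has no zero in the
barrier `X ≤ x ≤ X + √(1 − y₀²) (≤ X + 1)`, `y ≥ √(y₀² + 2(t − s)) (> 0)`, `0 ≤ s ≤ t`: implied by ONE
axis-inclusive barrier "no zero of `H_s` with `X ≤ Re z ≤ X + 1`, `0 < Im z ≤ 1`, `0 ≤ s ≤ T`".
No statement about horizontal velocities of near-axis zeros is needed.  The symmetries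
`z ↦ z̄` (`deBruijnH_conj_eq_zero`) and `z ↦ −z̄` (`Polymath15.zero_neg_conj`) reduce
`|Re z| ≤ X, Im z ≠ 0` to the quadrant `0 ≤ Re z ≤ X`, `Im z > 0`; `|Im z| < 1` for `t ≥ 0` is
`Polymath15.abs_im_lt_one_of_zero`.

## Main results (namespace `Summit.RiemannHypothesis.RiemannHypothesis.Theorems.DbnTheory`)

* `no_upper_zero_of_axisBarrier` — RH-FREE, quadrant form of the principle.
* `im_eq_zero_of_axisBarrier` — RH-FREE: numerical RH in the box `|Re z| ≤ X` at `t = 0` + the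
  axis barrier at `X` on `[0, T]` ⟹ every zero of `H_t` with `|Re z| ≤ X + 1` is real, `t ∈ [0, T]`.
* `im_eq_zero_deBruijnH_zero_of_platt_trudgian_numerical_rh` — CONDITIONAL(F1): every zero of `H_0`
  with `|Re z| ≤ 6 000 350 665 600` is real (Platt–Trudgian's height in the `z`-variable,
  `H_0(z) = ξ((1 + iz)/2)/8`).
* `dbnLowAllT_of_axisBarrier` — CONDITIONAL(F1, `platt_trudgian`): an axis barrier at any
  `X ∈ [6·10¹², 6 000 350 665 599]` on `t ∈ [0, 1/5]` gives `DBN.DbnLowAllT`;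
  `dbnLowAllT_of_numerics` — the same with `platt_trudgian` replaced by F3
  `Polymath15.table1_row2` (`platt_trudgian_of_numerics`).
* `dbnLowAllT_iff_axisBarrier_of_numerics` — CONDITIONAL(F1, `platt_trudgian`): `DBN.DbnLowAllT`
  is EQUIVALENT to the axis barrier at `X = 6·10¹² − 1` on `[0, 1/5]` — the residual is exact.

RESIDUAL OF RECORD FOR P2 (a certified computation, not run; format suggestion: Polymath 15 §8
winding certificates on `[X, X+1] × [y₁, 1]` plus a PARITY count — winding number of `H_t` around
`[X, X+1] × [−y₁, y₁]` equals the number of certified sign changes of `x ↦ H_t(x)` on `[X, X+1]` —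
on a `t`-cover of `[0, 1/5]` with `t`-Lipschitz bounds):
`∃ X, 6·10¹² ≤ X ∧ X ≤ 6 000 350 665 599 ∧ ∀ t x y : ℝ, 0 ≤ t → t ≤ 1/5 → X ≤ x → x ≤ X + 1 →
0 < y → y ≤ 1 → deBruijnH t (x + y·I) ≠ 0`.

`--supports stmt-RiemannHypothesis-0281` (route DBN crux #3, custody pub-dbn); closes nothing.
Theorems only (no `def`, no named fact introduced).

References (context; the content used is the tree's proof of Polymath 15 Prop. 3.3):
D. H. J. Polymath, Res. Math. Sci. 6 (2019) 31 = arXiv:1904.12438, Thm. 1.2, Prop. 3.3, §8, §10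
Table 1; D. Platt, T. Trudgian, Bull. LMS 53 (2021) 792–797, Thm. 1, Cor. 2; N. G. de Bruijn,
Duke Math. J. 17 (1950), Thm. 13.
-/

noncomputable section

-- D-0017: `Summit.<S>.<S>.…` is the designed namespace of a single-problem summit.
set_option linter.dupNamespace false

namespace Summit.RiemannHypothesis.RiemannHypothesis.Theorems.DbnTheory

open Literature.NumberTheory.LFunctions
open Summit.RiemannHypothesis.RiemannHypothesis.Theses
open Complex Set

/-! ## The sliding-floor principle (RH-FREE) -/

/-- **RH-FREE — the sliding-floor axis-barrier principle, quadrant form.**  Suppose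
(i) `H_0` has no zero `z` with `0 ≤ Re z ≤ X` and `Im z > 0`, and (ii) for every `s ∈ [0, T]`,
`H_s` has no zero `x + iy` with `X ≤ x ≤ X + 1` and `0 < y ≤ 1` (axis-inclusive barrier).  Then for
every `t ∈ [0, T]`, `H_t` has no zero `w` with `0 ≤ Re w ≤ X` and `Im w > 0`.  Proof: Polymath 15,
Prop. 3.3 (`Polymath15.not_bad`) at `t₀ := t`, `y₀ := Im w` — the floor `Y(t₀) = y₀` passes through
`w`. [cite: Polymath2019, Prop. 3.3] -/
theorem no_upper_zero_of_axisBarrier {X T : ℝ}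
    (h0 : ∀ z : ℂ, deBruijnH 0 z = 0 → 0 ≤ z.re → z.re ≤ X → 0 < z.im → False)
    (hbar : ∀ s x y : ℝ, 0 ≤ s → s ≤ T → X ≤ x → x ≤ X + 1 → 0 < y → y ≤ 1 →
      deBruijnH s (x + y * I) ≠ 0)
    {t : ℝ} (ht0 : 0 ≤ t) (htT : t ≤ T) {w : ℂ} (hw : deBruijnH t w = 0) (hre0 : 0 ≤ w.re)
    (hreX : w.re ≤ X) (him : 0 < w.im) : False := by
  -- the floor parameter `y₀ := Im w ∈ (0, 1]`
  have hy₁ : w.im ≤ 1 := (abs_lt.1 (Polymath15.abs_im_lt_one_of_zero ht0 hw)).2.le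
  -- (i) initial condition of Prop. 3.3 at `(t₀, y₀) = (t, Im w)`
  have h₁ : Polymath15.InitialZeroFreeH t X w.im := by
    intro x y hx hxX hy _ hzero
    have hypos : 0 < y := by
      refine lt_of_lt_of_le ?_ hy
      calc (0 : ℝ) < w.im := him
        _ = Real.sqrt (w.im ^ 2) := (Real.sqrt_sq him.le).symm
        _ ≤ Real.sqrt (w.im ^ 2 + 2 * t) := Real.sqrt_le_sqrt (by nlinarith)
    exact h0 (x + y * I) hzero (by simpa using hx) (by simpa using hxX) (by simpa using hypos)
  -- (ii) the barrier of Prop. 3.3 at `(t₀, y₀) = (t, Im w)` sits inside the axis barrier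
  have h₃ : Polymath15.BarrierZeroFree t X w.im := by
    intro s x y hs hst hXx hxX hy hy1
    have hypos : 0 < y := by
      refine lt_of_lt_of_le ?_ hy
      calc (0 : ℝ) < w.im := him
        _ = Real.sqrt (w.im ^ 2) := (Real.sqrt_sq him.le).symm
        _ ≤ Real.sqrt (w.im ^ 2 + 2 * (t - s)) := Real.sqrt_le_sqrt (by nlinarith)
    have hx1 : x ≤ X + 1 := by
      have hsq : Real.sqrt (1 - w.im ^ 2) ≤ 1 := by
        calc Real.sqrt (1 - w.im ^ 2) ≤ Real.sqrt 1 := Real.sqrt_le_sqrt (by nlinarith)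
          _ = 1 := Real.sqrt_one
      linarith
    have hyle : y ≤ 1 := by
      refine hy1.trans ?_
      calc Real.sqrt (1 - 2 * s) ≤ Real.sqrt 1 := Real.sqrt_le_sqrt (by linarith)
        _ = 1 := Real.sqrt_one
    exact hbar s x y hs (hst.trans htT) hXx hx1 hypos hyle
  -- `t` itself would be a bad time for this run
  have hbad : Polymath15.Bad t X w.im t :=
    ⟨w, hw, hre0, hreX, (Polymath15.Yfun_self him.le).le⟩
  exact Polymath15.not_bad h₁ h₃ him hy₁ ⟨ht0, le_rfl⟩ hbad

/-- **RH-FREE — the sliding-floor principle, symmetric form.**  If every zero of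
`H_0` with `|Re z| ≤ X` is real, and for every `s ∈ [0, T]` the function `H_s` has no zero
`x + iy` with `X ≤ x ≤ X + 1`, `0 < y ≤ 1`, then for every `t ∈ [0, T]` every zero of `H_t` with
`|Re z| ≤ X + 1` is real.  (Symmetries `z ↦ z̄`, `z ↦ −z̄` of the zero set; `|Im z| < 1` for `t ≥ 0`.)
[cite: Polymath2019, Prop. 3.3] -/
theorem im_eq_zero_of_axisBarrier {X T : ℝ}
    (h0 : ∀ z : ℂ, deBruijnH 0 z = 0 → |z.re| ≤ X → z.im = 0)
    (hbar : ∀ s x y : ℝ, 0 ≤ s → s ≤ T → X ≤ x → x ≤ X + 1 → 0 < y → y ≤ 1 →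
      deBruijnH s (x + y * I) ≠ 0)
    {t : ℝ} (ht0 : 0 ≤ t) (htT : t ≤ T) {z : ℂ} (hz : deBruijnH t z = 0) (hre : |z.re| ≤ X + 1) :
    z.im = 0 := by
  -- quadrant form of the initial condition
  have h0' : ∀ z : ℂ, deBruijnH 0 z = 0 → 0 ≤ z.re → z.re ≤ X → 0 < z.im → False := by
    intro u hu hu0 huX hui
    have := h0 u hu (by rw [abs_of_nonneg hu0]; exact huX)
    exact hui.ne' this
  -- no zero with positive imaginary part and `|Re| ≤ X + 1`, at any time in `[0, T]`
  have hupper : ∀ u : ℂ, deBruijnH t u = 0 → |u.re| ≤ X + 1 → 0 < u.im → False := by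
    intro u hu hure hui
    -- reflect to `Re u ≥ 0`
    wlog hu0 : 0 ≤ u.re generalizing u
    · refine this (-(starRingEnd ℂ u)) (Polymath15.zero_neg_conj hu) ?_ ?_ ?_
      · simpa using hure
      · simpa using hui
      · simp only [neg_re, conj_re, Left.nonneg_neg_iff]; exact (not_le.1 hu0).le
    rw [abs_of_nonneg hu0] at hure
    rcases le_or_gt u.re X with huX | huX
    · exact no_upper_zero_of_axisBarrier h0' hbar ht0 htT hu hu0 huX hui
    · -- inside the barrier strip itself
      have hui1 : u.im ≤ 1 := (abs_lt.1 (Polymath15.abs_im_lt_one_of_zero ht0 hu)).2.le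
      have := hbar t u.re u.im ht0 htT huX.le hure hui hui1
      exact this (by rw [re_add_im]; exact hu)
  by_contra him
  rcases lt_or_gt_of_ne him with hlt | hgt
  · -- `Im z < 0`: use the conjugate zero
    refine hupper (starRingEnd ℂ z) (deBruijnH_conj_eq_zero hz) (by simpa using hre) ?_
    simpa using hlt
  · exact hupper z hz hre hgt

/-- The axis barrier in "zeros are real" form implies the rectangle form used above (trivial
repackaging, recorded for certificate writers). [folklore] -/
theorem axisBarrier_of_im_eq_zero {X T : ℝ}
    (h : ∀ s : ℝ, 0 ≤ s → s ≤ T → ∀ z : ℂ, deBruijnH s z = 0 → X ≤ z.re → z.re ≤ X + 1 → z.im = 0) :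
    ∀ s x y : ℝ, 0 ≤ s → s ≤ T → X ≤ x → x ≤ X + 1 → 0 < y → y ≤ 1 →
      deBruijnH s (x + y * I) ≠ 0 := by
  intro s x y hs hsT hXx hx1 hy _ hzero
  have := h s hs hsT (x + y * I) hzero (by simpa using hXx) (by simpa using hx1)
  simp at this
  exact hy.ne' this

/-! ## Numerical RH at `t = 0` in the `z`-variable (CONDITIONAL on F1) -/

/-- **CONDITIONAL(F1)** — Platt–Trudgian's RH verification to height `3 000 175 332 800`
(`platt_trudgian_numerical_rh`) in the `z`-variable: every zero `z` of `H_0` with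
`|Re z| ≤ 6 000 350 665 600` is real (`H_0(x + iy) = 0 ⟹ ζ((1 + y)/2 + ix/2) = 0`,
`Polymath15.riemannZeta_eq_zero_of_deBruijnH_zero_eq_zero`; `Re z ≠ 0` for zeros,
`Polymath15.re_ne_zero_of_zero`). [cite: PlattTrudgianBLMS2021, Thm. 1] -/
theorem im_eq_zero_deBruijnH_zero_of_platt_trudgian_numerical_rh (h₁ : platt_trudgian_numerical_rh)
    {z : ℂ} (hz : deBruijnH 0 z = 0) (hre : |z.re| ≤ 6000350665600) : z.im = 0 := by
  -- reduce to `Re z > 0`, `Im z > 0` impossible (and `Im z < 0` by conjugation)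
  have key : ∀ u : ℂ, deBruijnH 0 u = 0 → |u.re| ≤ 6000350665600 → 0 < u.im → False := by
    intro u hu hure hui
    wlog hu0 : 0 ≤ u.re generalizing u
    · refine this (-(starRingEnd ℂ u)) (Polymath15.zero_neg_conj hu) ?_ ?_ ?_
      · simpa using hure
      · simpa using hui
      · simp only [neg_re, conj_re, Left.nonneg_neg_iff]; exact (not_le.1 hu0).le
    have hune : u.re ≠ 0 := Polymath15.re_ne_zero_of_zero hu
    have hupos : 0 < u.re := lt_of_le_of_ne hu0 (Ne.symm hune)
    rw [abs_of_nonneg hu0] at hure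
    have hu' : deBruijnH 0 ((u.re : ℂ) + (u.im : ℂ) * I) = 0 := by rw [re_add_im]; exact hu
    obtain ⟨hζ, -⟩ := Polymath15.riemannZeta_eq_zero_of_deBruijnH_zero_eq_zero hu'
    have hsre : ((((1 + u.im) / 2 : ℝ) : ℂ) + ((u.re / 2 : ℝ) : ℂ) * I).re = (1 + u.im) / 2 := by
      simp [Complex.add_re]
    have hsim : ((((1 + u.im) / 2 : ℝ) : ℂ) + ((u.re / 2 : ℝ) : ℂ) * I).im = u.re / 2 := by
      simp [Complex.add_im]
    have := h₁ _ hζ (by rw [hsim]; linarith) (by rw [hsim]; linarith)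
    rw [hsre] at this
    linarith
  by_contra him
  rcases lt_or_gt_of_ne him with hlt | hgt
  · exact key (starRingEnd ℂ z) (deBruijnH_conj_eq_zero hz) (by simpa using hre) (by simpa using hlt)
  · exact key z hz hre hgt

/-! ## The reduction of `DBN.DbnLowAllT` to one axis barrier (CONDITIONAL on F1 and `Λ ≤ 1/5`) -/

/-- **CONDITIONAL(F1, `platt_trudgian`) — `DBN.DbnLowAllT` from ONE axis-inclusive barrier.**
Assume F1 (`platt_trudgian_numerical_rh`) and `Λ ≤ 1/5` (`platt_trudgian`; = F1 + F3 by
`platt_trudgian_of_numerics`).  If for some `X` with `6·10¹² ≤ X ≤ 6 000 350 665 599` the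
function `H_t` has no zero `x + iy` with `X ≤ x ≤ X + 1`, `0 < y ≤ 1`, for all `t ∈ [0, 1/5]`
(ONE certified computation, not run), then every zero of every `H_t`, `t > 0`, with
`|Re z| < 6·10¹²` is real — the crux `DBN.DbnLowAllT` (stmt-RiemannHypothesis-0281).  For
`t ≤ 1/5`: the sliding-floor principle with numerical RH in the box `|Re z| ≤ X` at `t = 0`; for
`t > 1/5`: all zeros are real. [cite: Polymath2019, Prop. 3.3] [cite: PlattTrudgianBLMS2021, Thm. 1, Cor. 2] -/
theorem dbnLowAllT_of_axisBarrier (h₁ : platt_trudgian_numerical_rh) (h₂ : platt_trudgian)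
    {X : ℝ} (hX : 6000000000000 ≤ X) (hX' : X ≤ 6000350665599)
    (hbar : ∀ t x y : ℝ, 0 ≤ t → t ≤ 1 / 5 → X ≤ x → x ≤ X + 1 → 0 < y → y ≤ 1 →
      deBruijnH t (x + y * I) ≠ 0) :
    DBN.DbnLowAllT := by
  intro t ht z hz hre
  rcases le_or_gt t (1 / 5) with hle | hgt
  · have h0 : ∀ u : ℂ, deBruijnH 0 u = 0 → |u.re| ≤ X → u.im = 0 := fun u hu hure ↦
      im_eq_zero_deBruijnH_zero_of_platt_trudgian_numerical_rh h₁ hu (hure.trans (by linarith))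
    exact im_eq_zero_of_axisBarrier h0 hbar ht.le hle hz (by linarith)
  · exact h₂ t hgt z hz

/-- **CONDITIONAL(F1, F3)** — the same with the route's second computational fact F3
`Polymath15.table1_row2` in place of `platt_trudgian` (`platt_trudgian_of_numerics`): the crux
`DBN.DbnLowAllT` follows from F1, F3 and one axis-inclusive barrier certificate.
[cite: Polymath2019, §10, Table 1 (row 2)] [cite: PlattTrudgianBLMS2021, Thm. 1] -/
theorem dbnLowAllT_of_numerics (h₁ : platt_trudgian_numerical_rh) (h₃ : Polymath15.table1_row2)
    {X : ℝ} (hX : 6000000000000 ≤ X) (hX' : X ≤ 6000350665599)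
    (hbar : ∀ t x y : ℝ, 0 ≤ t → t ≤ 1 / 5 → X ≤ x → x ≤ X + 1 → 0 < y → y ≤ 1 →
      deBruijnH t (x + y * I) ≠ 0) :
    DBN.DbnLowAllT :=
  dbnLowAllT_of_axisBarrier h₁ (platt_trudgian_of_numerics h₁ h₃) hX hX' hbar

/-- **CONDITIONAL(F1, `platt_trudgian`) — the residual is EXACT.**  Given F1 and `Λ ≤ 1/5`, the
crux `DBN.DbnLowAllT` is EQUIVALENT to the axis-inclusive barrier in the half-open unit strip
`6·10¹² − 1 ≤ x < 6·10¹²`, `0 < y ≤ 1`, `t ∈ [0, 1/5]`: (⟹) for `t > 0` such a zero has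
`|Re z| < 6·10¹²` and is real by `DbnLowAllT`, at `t = 0` it is real by F1; (⟸) the sliding-floor
run of Prop. 3.3 at `X = 6·10¹² − 1`, `(t₀, y₀) = (t, Im w)`, whose barrier has width
`√(1 − y₀²) < 1` and so lies in the half-open strip.  Hence the declared residual of P2 loses
nothing. [cite: Polymath2019, Prop. 3.3] [cite: PlattTrudgianBLMS2021, Thm. 1] -/
theorem dbnLowAllT_iff_axisBarrier_of_numerics (h₁ : platt_trudgian_numerical_rh)
    (h₂ : platt_trudgian) :
    DBN.DbnLowAllT ↔ ∀ t x y : ℝ, 0 ≤ t → t ≤ 1 / 5 → 6000000000000 - 1 ≤ x →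
      x < 6000000000000 → 0 < y → y ≤ 1 → deBruijnH t (x + y * I) ≠ 0 := by
  constructor
  · intro h t x y ht0 _ _ hx1 hy _ hzero
    rcases ht0.eq_or_lt with rfl | htpos
    · have := im_eq_zero_deBruijnH_zero_of_platt_trudgian_numerical_rh h₁ hzero
        (by simp only [add_re, ofReal_re, mul_re, I_re, I_im, ofReal_im]; rw [abs_le]; constructor <;> linarith)
      simp at this
      exact hy.ne' this
    · have := h t htpos (x + y * I) hzero
        (by simp only [add_re, ofReal_re, mul_re, I_re, I_im, ofReal_im]; rw [abs_lt]; constructor <;> linarith)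
      simp at this
      exact hy.ne' this
  · intro hbar t ht z hz hre
    rcases le_or_gt t (1 / 5) with hle | hgt
    · -- sliding floor with `X = 6·10¹² − 1`, using the half-open strip: repackage
      have h0 : ∀ u : ℂ, deBruijnH 0 u = 0 → |u.re| ≤ 6000000000000 - 1 → u.im = 0 :=
        fun u hu hure ↦ im_eq_zero_deBruijnH_zero_of_platt_trudgian_numerical_rh h₁ hu
          (hure.trans (by norm_num))
      -- quadrant reduction by hand (the strip here is half-open, so we argue directly)
      have h0' : ∀ u : ℂ, deBruijnH 0 u = 0 → 0 ≤ u.re → u.re ≤ 6000000000000 - 1 → 0 < u.im →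
          False := by
        intro u hu hu0 huX hui
        have := h0 u hu (by rw [abs_of_nonneg hu0]; exact huX)
        exact hui.ne' this
      have hupper : ∀ u : ℂ, deBruijnH t u = 0 → |u.re| < 6000000000000 → 0 < u.im → False := by
        intro u hu hure hui
        wlog hu0 : 0 ≤ u.re generalizing u
        · refine this (-(starRingEnd ℂ u)) (Polymath15.zero_neg_conj hu) ?_ ?_ ?_
          · simpa using hure
          · simpa using hui
          · simp only [neg_re, conj_re, Left.nonneg_neg_iff]; exact (not_le.1 hu0).le
        rw [abs_of_nonneg hu0] at hure
        rcases le_or_gt u.re (6000000000000 - 1) with huX | huX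
        · -- run Prop. 3.3 directly: its barrier has width `√(1 − y₀²) < 1`, inside the
          -- half-open strip of `hbar`
          have hy₁ : u.im ≤ 1 := (abs_lt.1 (Polymath15.abs_im_lt_one_of_zero ht.le hu)).2.le
          have hy₁' : u.im < 1 := (abs_lt.1 (Polymath15.abs_im_lt_one_of_zero ht.le hu)).2
          have hI : Polymath15.InitialZeroFreeH t (6000000000000 - 1) u.im := by
            intro x y hx hxX hy _ hzero
            have hypos : 0 < y := by
              refine lt_of_lt_of_le ?_ hy
              calc (0 : ℝ) < u.im := hui
                _ = Real.sqrt (u.im ^ 2) := (Real.sqrt_sq hui.le).symm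
                _ ≤ Real.sqrt (u.im ^ 2 + 2 * t) := Real.sqrt_le_sqrt (by nlinarith)
            exact h0' (x + y * I) hzero (by simpa using hx) (by simpa using hxX) (by simpa using hypos)
          have hB : Polymath15.BarrierZeroFree t (6000000000000 - 1) u.im := by
            intro s x y hs hst hXx hxX hy hy1
            have hypos : 0 < y := by
              refine lt_of_lt_of_le ?_ hy
              calc (0 : ℝ) < u.im := hui
                _ = Real.sqrt (u.im ^ 2) := (Real.sqrt_sq hui.le).symm
                _ ≤ Real.sqrt (u.im ^ 2 + 2 * (t - s)) := Real.sqrt_le_sqrt (by nlinarith)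
            -- barrier width `√(1 − (Im u)²) < 1` since `0 < Im u`
            have hw : Real.sqrt (1 - u.im ^ 2) < 1 := by
              rw [Real.sqrt_lt' one_pos, one_pow]
              nlinarith
            have hyle : y ≤ 1 := by
              refine hy1.trans ?_
              calc Real.sqrt (1 - 2 * s) ≤ Real.sqrt 1 := Real.sqrt_le_sqrt (by linarith)
                _ = 1 := Real.sqrt_one
            exact hbar s x y hs (hst.trans hle) hXx (by linarith) hypos hyle
          exact Polymath15.not_bad hI hB hui hy₁ ⟨ht.le, le_rfl⟩
            ⟨u, hu, hu0, huX, (Polymath15.Yfun_self hui.le).le⟩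
        · have hui1 : u.im ≤ 1 := (abs_lt.1 (Polymath15.abs_im_lt_one_of_zero ht.le hu)).2.le
          have := hbar t u.re u.im ht.le hle huX.le hure hui hui1
          exact this (by rw [re_add_im]; exact hu)
      by_contra him
      rcases lt_or_gt_of_ne him with hlt | hgt'
      · exact hupper (starRingEnd ℂ z) (deBruijnH_conj_eq_zero hz) (by simpa using hre)
          (by simpa using hlt)
      · exact hupper z hz hre hgt'
    · exact h₂ t hgt z hz

end Summit.RiemannHypothesis.RiemannHypothesis.Theorems.DbnTheory

end
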